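import Literature.Analysis.FluidPDE.GaussianVortexFormDomainWeightMul
import Mathlib.Analysis.FunctionalSpaces.SobolevInequality
import HarnessLib

/-!
# The flat Nash inequality and the flat velocity bound on the form domain `H¹(μ_λ)`

Analysis/FluidPDE file (all results proved, no definitions, no named facts), part of the
existence theory behind the named fact `GallayMaekawa2016_thm41` (Gallay–Maekawa 2016, Thm. 4.1,
Leray–Schauder part). For `U = (u, G) ∈ H = H¹(μ_λ)` and the vorticity `w = ρ_λ u`
(`∇w = ρ_λ(G − u b_λ)` weakly) we express the three flat quantities

  `‖w‖²_{L²(dx)} = ⟪u, (ρU)₁⟫_{L²(μ)}`,  `‖w‖_{L¹(dx)} = ∫ |ρ u| dx`,  `‖∇w‖²_{L²(dx)} = ∫ ρ ‖G − u b‖² dμ_λ`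

and prove, by density from `w = ρ_λψ ∈ C_c^∞`:

* `sq_integral_sq_le_nash` — the planar **Nash inequality** `‖f‖₂⁴ ≤ 4 C_GNS ‖f‖₁² ‖∇f‖₂²` for
  `f ∈ C¹_c(ℝ²)`, from Mathlib's Gagliardo–Nirenberg–Sobolev inequality
  (`lintegral_pow_le_pow_lintegral_fderiv`, `n = 2`, `p = 1`: `‖f²‖₂ ≤ C^{1/2} ‖∇(f²)‖₁`) and two
  Cauchy–Schwarz inequalities (`(∫f²)³ ≤ (∫|f|)² ∫f⁴`);
* `flatNash_of_mem_gaussLamFormDomain` — its form on `H`: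
  `⟪u,(ρU)₁⟫² ≤ 4 C_GNS (∫|ρu|)² ∫ ρ‖G − ub‖² dμ_λ`;
* `integral_sq_weight_div_norm_sub_le_flat` — the flat **Hardy bound** on `H`:
  `∫ (ρu)²/|y − x₀| dy ≤ 2 ⟪u,(ρU)₁⟫^{1/2} (∫ ρ‖G − ub‖² dμ_λ)^{1/2}`;
* `norm_biotSavart2D_weight_mul_le_flat` — the **velocity bound**: for every `t > 0`,
  `‖(K_{2D} ∗ ρu)(x₀)‖ ≤ (2π)⁻¹ ((t · 2⟪u,(ρU)₁⟫^{1/2}(∫ρ‖G−ub‖²dμ)^{1/2} + t⁻¹ I₁)/2 + ∫|ρu|)`,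
  `I₁ = ∫_{|z|<1} |z|⁻¹ dz`.

These are the `κ`-independent ingredients of the a priori bounds for the Leray–Schauder map:
they involve only flat norms of `w`, for which the transport term drops out.

## References

* Th. Gallay, Y. Maekawa, *Existence and stability of viscous vortices*, arXiv:1610.08384, §4.1,
  Thm. 4.1. [GallayMaekawa2016]
* J. Nash, *Continuity of solutions of parabolic and elliptic equations*, Amer. J. Math. 80 (1958)
  931–954 (the inequality `‖f‖₂^{1+2/n} ≤ C ‖f‖₁^{2/n} ‖∇f‖₂`). [folklore]
-/

open MeasureTheory Filter Set WithLp Metric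
open scoped Real RealInnerProductSpace Topology InnerProductSpace ContDiff ENNReal NNReal

noncomputable section

namespace Literature.Analysis.FluidPDE

open Literature.Analysis.UnboundedOperators

variable {lam : ℝ}

/-! ### Cauchy–Schwarz and the planar Nash inequality for `C¹_c` functions -/

section Nash

/-- **Cauchy–Schwarz** for non-negative continuous compactly supported functions on `ℝ²`:
`(∫ f g)² ≤ (∫ f²)(∫ g²)`. [folklore] -/
theorem sq_integral_mul_le_of_nonneg {f g : EuclideanSpace ℝ (Fin 2) → ℝ} (hf : Continuous f)
    (hg : Continuous g) (hfc : HasCompactSupport f) (hgc : HasCompactSupport g)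
    (hf0 : ∀ x, 0 ≤ f x) (hg0 : ∀ x, 0 ≤ g x) :
    (∫ x, f x * g x) ^ 2 ≤ (∫ x, f x ^ 2) * ∫ x, g x ^ 2 := by
  have h := integral_mul_le_Lp_mul_Lq_of_nonneg (μ := (volume : Measure (EuclideanSpace ℝ (Fin 2))))
    Real.HolderConjugate.two_two (Eventually.of_forall hf0) (Eventually.of_forall hg0)
    (hf.memLp_of_hasCompactSupport hfc) (hg.memLp_of_hasCompactSupport hgc)
  have hA : 0 ≤ ∫ x, f x ^ 2 := integral_nonneg fun x => by positivity
  have hB : 0 ≤ ∫ x, g x ^ 2 := integral_nonneg fun x => by positivity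
  have hI : 0 ≤ ∫ x, f x * g x := integral_nonneg fun x => mul_nonneg (hf0 x) (hg0 x)
  have hA' : (∫ x, f x ^ (2 : ℝ)) = ∫ x, f x ^ 2 :=
    integral_congr_ae (Eventually.of_forall fun x => by simp)
  have hB' : (∫ x, g x ^ (2 : ℝ)) = ∫ x, g x ^ 2 :=
    integral_congr_ae (Eventually.of_forall fun x => by simp)
  rw [hA', hB', show (1 : ℝ) / 2 = 2⁻¹ by norm_num] at h
  have h2 := pow_le_pow_left₀ hI h 2
  rw [mul_pow, ← Real.rpow_natCast ((∫ x, f x ^ 2) ^ (2⁻¹ : ℝ)) 2,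
    ← Real.rpow_natCast ((∫ x, g x ^ 2) ^ (2⁻¹ : ℝ)) 2, ← Real.rpow_mul hA, ← Real.rpow_mul hB] at h2
  norm_num at h2
  exact h2

/-- **The planar Nash inequality**: for `f ∈ C¹_c(ℝ²)`,
`(∫ f²)² ≤ 4 C_GNS (∫ |f|)² ∫ ‖Df‖²`, `C_GNS` Mathlib's Gagliardo–Nirenberg–Sobolev constant of
`ℝ²` for `p = 2` (`lintegralPowLePowLIntegralFDerivConst`). Proof: GNS for `f²` gives
`∫ f⁴ ≤ C (∫ ‖D(f²)‖)² = C (∫ 2|f|‖Df‖)² ≤ 4C (∫f²)(∫‖Df‖²)`, and Cauchy–Schwarz twice gives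
`(∫f²)³ ≤ (∫|f|)² ∫f⁴`. [folklore] -/
theorem sq_integral_sq_le_nash {f : EuclideanSpace ℝ (Fin 2) → ℝ} (hf : ContDiff ℝ 1 f)
    (hfc : HasCompactSupport f) :
    (∫ x, f x ^ 2) ^ 2 ≤
      4 * (lintegralPowLePowLIntegralFDerivConst (volume : Measure (EuclideanSpace ℝ (Fin 2))) 2 : ℝ) *
        (∫ x, |f x|) ^ 2 * ∫ x, ‖fderiv ℝ f x‖ ^ 2 := by
  set C : ℝ≥0 := lintegralPowLePowLIntegralFDerivConst (volume : Measure (EuclideanSpace ℝ (Fin 2))) 2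
    with hC
  have hfd : Differentiable ℝ f := hf.differentiable (by simp)
  have hfcont : Continuous f := hf.continuous
  have hDc : Continuous fun x => fderiv ℝ f x := hf.continuous_fderiv (by simp)
  have hDs : HasCompactSupport fun x => fderiv ℝ f x := hfc.fderiv (𝕜 := ℝ)
  -- the four flat quantities
  set X : ℝ := ∫ x, f x ^ 2 with hX
  set a : ℝ := ∫ x, |f x| with ha
  set T : ℝ := ∫ x, |f x| ^ 3 with hT
  set Q : ℝ := ∫ x, f x ^ 4 with hQ
  set D : ℝ := ∫ x, ‖fderiv ℝ f x‖ ^ 2 with hD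
  have hX0 : 0 ≤ X := integral_nonneg fun x => by positivity
  have ha0 : 0 ≤ a := integral_nonneg fun x => by positivity
  have hT0 : 0 ≤ T := integral_nonneg fun x => by positivity
  have hQ0 : 0 ≤ Q := integral_nonneg fun x => by positivity
  have hD0 : 0 ≤ D := integral_nonneg fun x => by positivity
  -- compact supports of the auxiliary functions
  have hsupp_of : ∀ {g : EuclideanSpace ℝ (Fin 2) → ℝ}, (∀ x, f x = 0 → g x = 0) → HasCompactSupport g :=
    fun {g} hg => hfc.mono fun x hx => by
      simp only [Function.mem_support, ne_eq] at hx ⊢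
      contrapose! hx
      exact hg x hx
  -- (A) Cauchy–Schwarz twice: `X² ≤ a T`, `T² ≤ X Q`
  have hCS1 : X ^ 2 ≤ a * T := by
    have h := sq_integral_mul_le_of_nonneg (f := fun x => Real.sqrt |f x|)
      (g := fun x => |f x| * Real.sqrt |f x|) (by fun_prop) (by fun_prop)
      (hsupp_of fun x hx => by simp [hx]) (hsupp_of fun x hx => by simp [hx])
      (fun x => Real.sqrt_nonneg _) (fun x => by positivity)
    have e1 : (fun x => Real.sqrt |f x| * (|f x| * Real.sqrt |f x|)) = fun x => f x ^ 2 := by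
      funext x
      have hs := Real.mul_self_sqrt (abs_nonneg (f x))
      calc Real.sqrt |f x| * (|f x| * Real.sqrt |f x|) = (Real.sqrt |f x| * Real.sqrt |f x|) * |f x| := by ring
        _ = |f x| * |f x| := by rw [hs]
        _ = f x ^ 2 := by rw [← sq, sq_abs]
    have e2 : (fun x => Real.sqrt |f x| ^ 2) = fun x => |f x| := by
      funext x; exact Real.sq_sqrt (abs_nonneg _)
    have e3 : (fun x => (|f x| * Real.sqrt |f x|) ^ 2) = fun x => |f x| ^ 3 := by
      funext x
      rw [mul_pow, Real.sq_sqrt (abs_nonneg _)]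
      ring
    simp only [e1, e2, e3] at h
    exact h
  have hCS2 : T ^ 2 ≤ X * Q := by
    have h := sq_integral_mul_le_of_nonneg (f := fun x => |f x|) (g := fun x => f x ^ 2)
      (by fun_prop) (by fun_prop) (hsupp_of fun x hx => by simp [hx]) (hsupp_of fun x hx => by simp [hx])
      (fun x => abs_nonneg _) (fun x => by positivity)
    have e1 : (fun x => |f x| * f x ^ 2) = fun x => |f x| ^ 3 := by
      funext x; rw [← sq_abs]; ring
    have e2 : (fun x => |f x| ^ 2) = fun x => f x ^ 2 := by funext x; exact sq_abs _
    have e3 : (fun x => (f x ^ 2) ^ 2) = fun x => f x ^ 4 := by funext x; ring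
    simp only [e1, e2, e3] at h
    exact h
  -- (B) Gagliardo–Nirenberg–Sobolev for `f²`: `Q ≤ C (∫ ‖D(f²)‖)²`
  set u : EuclideanSpace ℝ (Fin 2) → ℝ := fun x => f x ^ 2 with hu
  have huc : ContDiff ℝ 1 u := hf.pow 2
  have hus : HasCompactSupport u := hsupp_of fun x hx => by simp [hu, hx]
  have hud : ∀ x, HasFDerivAt u ((2 * f x) • fderiv ℝ f x) x := by
    intro x
    have := ((hfd x).hasFDerivAt).pow 2
    simpa using this
  have hDu : ∀ x, ‖fderiv ℝ u x‖ = 2 * |f x| * ‖fderiv ℝ f x‖ := by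
    intro x
    rw [(hud x).fderiv, norm_smul, Real.norm_eq_abs, abs_mul, abs_of_pos two_pos]
  have hp : Real.HolderConjugate (Module.finrank ℝ (EuclideanSpace ℝ (Fin 2)) : ℝ) 2 := by
    rw [finrank_euclideanSpace_fin]
    exact_mod_cast Real.HolderConjugate.two_two
  have hGNS := lintegral_pow_le_pow_lintegral_fderiv (volume : Measure (EuclideanSpace ℝ (Fin 2)))
    huc hus hp
  -- convert the `lintegral` statement to real integrals
  have hDui : Integrable fun x => ‖fderiv ℝ u x‖ := by
    have : (fun x => ‖fderiv ℝ u x‖) = fun x => 2 * |f x| * ‖fderiv ℝ f x‖ := funext hDu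
    rw [this]
    exact ((continuous_const.mul hfcont.abs).mul hDc.norm).integrable_of_hasCompactSupport
      ((hsupp_of fun x hx => by simp [hx]))
  have hQi : Integrable fun x => f x ^ 4 :=
    (hfcont.pow 4).integrable_of_hasCompactSupport (hsupp_of fun x hx => by simp [hx])
  have hL : ∫⁻ x, ‖u x‖ₑ ^ (2 : ℝ) = ENNReal.ofReal Q := by
    rw [hQ, ofReal_integral_eq_lintegral_ofReal hQi (Eventually.of_forall fun x => by positivity)]
    refine lintegral_congr fun x => ?_
    rw [Real.enorm_eq_ofReal (by positivity : 0 ≤ u x), ENNReal.ofReal_rpow_of_nonneg (by positivity)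
      (by norm_num)]
    congr 1
    rw [hu]; simp only [Real.rpow_two]; ring
  have hR : ∫⁻ x, ‖fderiv ℝ u x‖ₑ = ENNReal.ofReal (∫ x, ‖fderiv ℝ u x‖) := by
    rw [ofReal_integral_eq_lintegral_ofReal hDui (Eventually.of_forall fun x => norm_nonneg _)]
    exact lintegral_congr fun x => (ofReal_norm _).symm
  have hGNS' : Q ≤ C * (∫ x, ‖fderiv ℝ u x‖) ^ 2 := by
    rw [hL, hR, ENNReal.rpow_two, ← ENNReal.ofReal_pow (integral_nonneg fun x => norm_nonneg _),
      ← ENNReal.ofReal_coe_nnreal, ← ENNReal.ofReal_mul (NNReal.coe_nonneg _)] at hGNS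
    exact (ENNReal.ofReal_le_ofReal_iff (by positivity)).1 hGNS
  -- `∫ ‖D(f²)‖ = ∫ 2|f|‖Df‖ ≤ 2 √X √D`
  have hDuint : (∫ x, ‖fderiv ℝ u x‖) ^ 2 ≤ 4 * X * D := by
    have h := sq_integral_mul_le_of_nonneg (f := fun x => |f x|) (g := fun x => ‖fderiv ℝ f x‖)
      (by fun_prop) hDc.norm (hsupp_of fun x hx => by simp [hx])
      (hDs.norm) (fun x => abs_nonneg _) (fun x => norm_nonneg _)
    have e2 : (fun x => |f x| ^ 2) = fun x => f x ^ 2 := by funext x; exact sq_abs _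
    simp only [e2] at h
    have e1 : ∫ x, ‖fderiv ℝ u x‖ = 2 * ∫ x, |f x| * ‖fderiv ℝ f x‖ := by
      rw [← integral_const_mul]
      exact integral_congr_ae (Eventually.of_forall fun x => by dsimp only; rw [hDu x]; ring)
    rw [e1, mul_pow]
    linarith
  have hQle : Q ≤ 4 * C * X * D := by
    calc Q ≤ C * (∫ x, ‖fderiv ℝ u x‖) ^ 2 := hGNS'
      _ ≤ C * (4 * X * D) := mul_le_mul_of_nonneg_left hDuint (NNReal.coe_nonneg _)
      _ = 4 * C * X * D := by ring
  -- (C) combine: `X⁴ ≤ a² T² ≤ a² X Q ≤ 4 C a² X² D`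
  have hC0 : 0 ≤ (C : ℝ) := NNReal.coe_nonneg _
  by_cases hX00 : X = 0
  · rw [hX00, zero_pow two_ne_zero]
    exact mul_nonneg (mul_nonneg (mul_nonneg (by norm_num) hC0) (sq_nonneg a)) hD0
  have hXpos : 0 < X := lt_of_le_of_ne hX0 (Ne.symm hX00)
  have h4 : X ^ 4 ≤ a ^ 2 * (X * Q) := by
    calc X ^ 4 = (X ^ 2) ^ 2 := by ring
      _ ≤ (a * T) ^ 2 := pow_le_pow_left₀ (by positivity) hCS1 2
      _ = a ^ 2 * T ^ 2 := by ring
      _ ≤ a ^ 2 * (X * Q) := mul_le_mul_of_nonneg_left hCS2 (by positivity)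
  have h5 : X ^ 4 ≤ X ^ 2 * (4 * C * a ^ 2 * D) := by
    calc X ^ 4 ≤ a ^ 2 * (X * Q) := h4
      _ ≤ a ^ 2 * (X * (4 * C * X * D)) := by gcongr
      _ = X ^ 2 * (4 * C * a ^ 2 * D) := by ring
  have h6 : X ^ 2 ≤ 4 * C * a ^ 2 * D := by
    have hX2 : 0 < X ^ 2 := by positivity
    calc X ^ 2 = X ^ 4 / X ^ 2 := by field_simp
      _ ≤ X ^ 2 * (4 * C * a ^ 2 * D) / X ^ 2 := by gcongr
      _ = 4 * C * a ^ 2 * D := by field_simp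
  linarith [h6]

end Nash

/-! ### The flat quantities on `H¹(μ_λ)` and the Nash inequality on `H` -/

section OnH

variable (hlam : lam ∈ Set.Ico (0 : ℝ) 1)
include hlam

/-- `G ↦ ρ_λ G` is `1`-Lipschitz on `L²(μ_λ; ℝ²)`. [folklore] -/
theorem norm_weight_smul_snd_sub_le (G G' : Lp (EuclideanSpace ℝ (Fin 2)) 2 (gaussLamMeasure lam)) :
    ‖(memLp_weight_smul_snd hlam G).toLp _ - (memLp_weight_smul_snd hlam G').toLp _‖ ≤ 1 * ‖G - G'‖ := by
  refine Lp.norm_le_mul_norm_of_ae_le_mul ?_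
  filter_upwards [Lp.coeFn_sub ((memLp_weight_smul_snd hlam G).toLp _) ((memLp_weight_smul_snd hlam G').toLp _),
    Lp.coeFn_sub G G', MemLp.coeFn_toLp (memLp_weight_smul_snd hlam G),
    MemLp.coeFn_toLp (memLp_weight_smul_snd hlam G')] with x hx1 hx2 hx3 hx4
  rw [hx1, Pi.sub_apply, hx3, hx4, ← smul_sub, norm_smul, hx2, Pi.sub_apply, one_mul,
    Real.norm_of_nonneg (Real.exp_pos _).le]
  exact mul_le_of_le_one_left (norm_nonneg _) (expNegQuadLam_le_one hlam x)

/-- Continuity of `G ↦ ρ_λ G` on `L²(μ_λ; ℝ²)`. [folklore] -/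
theorem continuous_weight_smul_snd :
    Continuous fun G : Lp (EuclideanSpace ℝ (Fin 2)) 2 (gaussLamMeasure lam) =>
      (memLp_weight_smul_snd hlam G).toLp _ := by
  refine (LipschitzWith.of_dist_le' (K := 1) fun G G' => ?_).continuous
  rw [dist_eq_norm, dist_eq_norm]
  exact norm_weight_smul_snd_sub_le hlam G G'

/-- **Continuity of the flat `L¹` norm `u ↦ ∫ |ρ_λ u| dx` on `L²(μ_λ)`**
(`|∫|ρu| − ∫|ρu'|| ≤ ∫ |ρ(u − u')| ≤ (∫ρ)^{1/2} ‖u − u'‖`). [folklore] -/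
theorem continuous_integral_abs_weight_mul :
    Continuous fun u : Lp ℝ 2 (gaussLamMeasure lam) =>
      ∫ x : EuclideanSpace ℝ (Fin 2), |Real.exp (-((1 + lam) / 4 * x 0 ^ 2 + (1 - lam) / 4 * x 1 ^ 2)) *
        (u : EuclideanSpace ℝ (Fin 2) → ℝ) x| := by
  set Z : ℝ := ∫ y : EuclideanSpace ℝ (Fin 2),
    Real.exp (-((1 + lam) / 4 * y 0 ^ 2 + (1 - lam) / 4 * y 1 ^ 2)) with hZ
  refine (LipschitzWith.of_dist_le' (K := Real.sqrt Z) fun u u' => ?_).continuous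
  obtain ⟨hi, -⟩ := integrable_weight_mul_Lp hlam u
  obtain ⟨hi', -⟩ := integrable_weight_mul_Lp hlam u'
  obtain ⟨hid, hled⟩ := integrable_weight_mul_Lp hlam (u - u')
  rw [dist_eq_norm, dist_eq_norm, Real.norm_eq_abs, ← integral_sub hi.abs hi'.abs]
  refine (abs_integral_le_integral_abs).trans ((integral_mono_ae (hi.abs.sub hi'.abs).abs hid.abs ?_).trans hled)
  filter_upwards [(ae_gaussLamMeasure_iff lam).1 (Lp.coeFn_sub u u')] with x hx
  rw [hx]
  simp only [Pi.sub_apply, mul_sub]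
  exact abs_abs_sub_abs_le_abs_sub _ _

/-- **The flat Nash inequality on `H¹(μ_λ)`**: for `U = (u, G) ∈ H` and `w = ρ_λ u`,
`‖w‖₂⁴ ≤ 4 C_GNS ‖w‖₁² ‖∇w‖₂²`, i.e.
`⟪u,(ρU)₁⟫² ≤ 4 C_GNS (∫|ρu| dx)² ∫ ρ‖G − u b‖² dμ_λ` (closure of `sq_integral_sq_le_nash` for
`w = ρ_λψ`; all three flat quantities are continuous on `L²(μ_λ) × L²(μ_λ;ℝ²)`). [folklore] -/
theorem flatNash_of_mem_gaussLamFormDomain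
    {U : WithLp 2 (Lp ℝ 2 (gaussLamMeasure lam) × Lp (EuclideanSpace ℝ (Fin 2)) 2 (gaussLamMeasure lam))}
    (hU : U ∈ gaussLamFormDomain lam) :
    ⟪U.fst, (memLp_weight_mul_fst hlam U.fst).toLp _⟫ ^ 2 ≤
      4 * (lintegralPowLePowLIntegralFDerivConst (volume : Measure (EuclideanSpace ℝ (Fin 2))) 2 : ℝ) *
        (∫ x : EuclideanSpace ℝ (Fin 2), |Real.exp (-((1 + lam) / 4 * x 0 ^ 2 + (1 - lam) / 4 * x 1 ^ 2)) *
          (U.fst : EuclideanSpace ℝ (Fin 2) → ℝ) x|) ^ 2 *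
        ∫ x, Real.exp (-((1 + lam) / 4 * x 0 ^ 2 + (1 - lam) / 4 * x 1 ^ 2)) *
          ‖(U.snd : EuclideanSpace ℝ (Fin 2) → EuclideanSpace ℝ (Fin 2)) x -
            (U.fst : EuclideanSpace ℝ (Fin 2) → ℝ) x •
              (toLp 2 ![(1 + lam) / 2 * x 0, (1 - lam) / 2 * x 1] : EuclideanSpace ℝ (Fin 2))‖ ^ 2
          ∂gaussLamMeasure lam := by
  set C : ℝ := (lintegralPowLePowLIntegralFDerivConst (volume : Measure (EuclideanSpace ℝ (Fin 2))) 2 : ℝ)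
    with hC
  set ρ : EuclideanSpace ℝ (Fin 2) → ℝ := fun x =>
    Real.exp (-((1 + lam) / 4 * x 0 ^ 2 + (1 - lam) / 4 * x 1 ^ 2)) with hρ
  set bv : EuclideanSpace ℝ (Fin 2) → EuclideanSpace ℝ (Fin 2) := fun x =>
    toLp 2 ![(1 + lam) / 2 * x 0, (1 - lam) / 2 * x 1] with hbv
  -- rewrite the flat gradient energy through the continuous expression
  obtain ⟨-, hexp⟩ := integral_weight_mul_norm_sub_smul_sq_eq hlam U.fst U.snd
  rw [hexp]
  -- the closed property
  refine gaussLamFormDomain_induction lam (P := fun V =>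
      ⟪V.fst, (memLp_weight_mul_fst hlam V.fst).toLp _⟫ ^ 2 ≤
        4 * C * (∫ x, |ρ x * (V.fst : EuclideanSpace ℝ (Fin 2) → ℝ) x|) ^ 2 *
          (⟪V.snd, (memLp_weight_smul_snd hlam V.snd).toLp _⟫ -
            2 * ⟪V.snd, (memLp_fst_smul_weight_drift hlam V.fst).toLp _⟫ +
            ⟪V.fst, (memLp_weight_normSq_drift_mul hlam V.fst).toLp _⟫)) ?_ ?_ hU
  · have hfst := WithLp.continuous_fst 2 (Lp ℝ 2 (gaussLamMeasure lam))
      (Lp (EuclideanSpace ℝ (Fin 2)) 2 (gaussLamMeasure lam))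
    have hsnd := WithLp.continuous_snd 2 (Lp ℝ 2 (gaussLamMeasure lam))
      (Lp (EuclideanSpace ℝ (Fin 2)) 2 (gaussLamMeasure lam))
    refine isClosed_le ?_ ?_
    · exact (hfst.inner ((continuous_weight_mul_fst hlam).comp hfst)).pow 2
    · refine ((continuous_const.mul (((continuous_integral_abs_weight_mul hlam).comp hfst).pow 2)).mul ?_)
      exact ((hsnd.inner ((continuous_weight_smul_snd hlam).comp hsnd)).sub
        (continuous_const.mul (hsnd.inner ((continuous_fst_smul_weight_drift hlam).comp hfst)))).add
        (hfst.inner ((continuous_weight_normSq_drift_mul hlam).comp hfst))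
  · intro ψ
    -- on graphs: the flat quantities of `f = ρ ψ`
    obtain ⟨-, hexpψ⟩ := integral_weight_mul_norm_sub_smul_sq_eq hlam (gaussLamGraph lam ψ).fst
      (gaussLamGraph lam ψ).snd
    rw [← hexpψ]
    set f : EuclideanSpace ℝ (Fin 2) → ℝ := fun x => ρ x * (ψ : EuclideanSpace ℝ (Fin 2) → ℝ) x with hf
    have hψc := planarTestFunctions.contDiff ψ
    have hψs := planarTestFunctions.hasCompactSupport ψ
    have hfC : ContDiff ℝ 1 f := ((contDiff_exp_neg_quadraticLam lam).mul hψc).of_le (by simp)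
    have hfs : HasCompactSupport f := hψs.mul_left
    have hnash := sq_integral_sq_le_nash hfC hfs
    have haeψ := MemLp.coeFn_toLp (memLp_planarTestFunction lam ψ)
    have haeG := MemLp.coeFn_toLp (memLp_gradient_planarTestFunction lam ψ)
    -- `X`
    have eX : ⟪(gaussLamGraph lam ψ).fst, (memLp_weight_mul_fst hlam (gaussLamGraph lam ψ).fst).toLp _⟫ =
        ∫ x, f x ^ 2 := by
      rw [inner_fst_weightMul_fst_eq hlam, integral_gaussLamMeasure]
      refine integral_congr_ae ((ae_gaussLamMeasure_iff lam).1 ?_)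
      filter_upwards [haeψ] with x hx
      rw [gaussLamGraph_fst, hx, hf]
      ring
    -- `M`
    have eM : ∫ x, |ρ x * ((gaussLamGraph lam ψ).fst : EuclideanSpace ℝ (Fin 2) → ℝ) x| = ∫ x, |f x| := by
      refine integral_congr_ae ((ae_gaussLamMeasure_iff lam).1 ?_)
      filter_upwards [haeψ] with x hx
      rw [gaussLamGraph_fst, hx]
    -- `D`
    have eD : ∫ x, ρ x * ‖((gaussLamGraph lam ψ).snd : EuclideanSpace ℝ (Fin 2) → EuclideanSpace ℝ (Fin 2)) x -
          ((gaussLamGraph lam ψ).fst : EuclideanSpace ℝ (Fin 2) → ℝ) x • bv x‖ ^ 2 ∂gaussLamMeasure lam =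
        ∫ x, ‖fderiv ℝ f x‖ ^ 2 := by
      rw [integral_gaussLamMeasure]
      refine integral_congr_ae ((ae_gaussLamMeasure_iff lam).1 ?_)
      filter_upwards [haeψ, haeG] with x hx hx'
      rw [gaussLamGraph_fst, gaussLamGraph_snd, hx, hx', ← norm_gradient_eq_norm_fderiv_fin_two, hf,
        gradient_weight_mul (hψc.differentiable (by simp)), norm_smul, mul_pow,
        Real.norm_of_nonneg (Real.exp_pos _).le]
      simp only [hρ, hbv]
      ring
    rw [eX, eM, eD]
    exact hnash

end OnH

/-! ### The flat Hardy bound and the velocity bound on `H¹(μ_λ)` -/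

section Velocity

variable (hlam : lam ∈ Set.Ico (0 : ℝ) 1)
include hlam

/-- **The flat Hardy bound on `H¹(μ_λ)`**: for `U = (u, G) ∈ H`, `w = ρ_λ u` and every `x₀`,
`∫ w(y)²/|y − x₀| dy ≤ 2 ⟪u,(ρU)₁⟫^{1/2} (∫ ρ‖G − ub‖² dμ_λ)^{1/2} = 2‖w‖₂‖∇w‖₂`
(`integral_sq_div_norm_sub_le` for `ρ_λψₙ` along graphs `ψₙ → U`, Fatou on the left, continuity
of the flat quantities on the right). [folklore] -/
theorem integral_sq_weight_div_norm_sub_le_flat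
    {U : WithLp 2 (Lp ℝ 2 (gaussLamMeasure lam) × Lp (EuclideanSpace ℝ (Fin 2)) 2 (gaussLamMeasure lam))}
    (hU : U ∈ gaussLamFormDomain lam) (x₀ : EuclideanSpace ℝ (Fin 2)) :
    ∫ y : EuclideanSpace ℝ (Fin 2),
        (Real.exp (-((1 + lam) / 4 * y 0 ^ 2 + (1 - lam) / 4 * y 1 ^ 2)) *
          (U.fst : EuclideanSpace ℝ (Fin 2) → ℝ) y) ^ 2 / ‖y - x₀‖ ≤
      2 * Real.sqrt ⟪U.fst, (memLp_weight_mul_fst hlam U.fst).toLp _⟫ *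
        Real.sqrt (∫ x, Real.exp (-((1 + lam) / 4 * x 0 ^ 2 + (1 - lam) / 4 * x 1 ^ 2)) *
          ‖(U.snd : EuclideanSpace ℝ (Fin 2) → EuclideanSpace ℝ (Fin 2)) x -
            (U.fst : EuclideanSpace ℝ (Fin 2) → ℝ) x •
              (toLp 2 ![(1 + lam) / 2 * x 0, (1 - lam) / 2 * x 1] : EuclideanSpace ℝ (Fin 2))‖ ^ 2
          ∂gaussLamMeasure lam) := by
  have hq : 0 < 1 - lam := by linarith [hlam.2]
  set ρ : EuclideanSpace ℝ (Fin 2) → ℝ := fun y =>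
    Real.exp (-((1 + lam) / 4 * y 0 ^ 2 + (1 - lam) / 4 * y 1 ^ 2)) with hρ_def
  set bv : EuclideanSpace ℝ (Fin 2) → EuclideanSpace ℝ (Fin 2) := fun x =>
    toLp 2 ![(1 + lam) / 2 * x 0, (1 - lam) / 2 * x 1] with hbv
  have hρpos : ∀ y, 0 < ρ y := fun y => Real.exp_pos _
  have hρc : Continuous ρ := continuous_expNegQuadLam lam
  -- the continuous flat functionals `X`, `R` (`R = D` by `integral_weight_mul_norm_sub_smul_sq_eq`)
  set Xf : WithLp 2 (Lp ℝ 2 (gaussLamMeasure lam) × Lp (EuclideanSpace ℝ (Fin 2)) 2 (gaussLamMeasure lam)) → ℝ :=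
    fun V => ⟪V.fst, (memLp_weight_mul_fst hlam V.fst).toLp _⟫ with hXf
  set Rf : WithLp 2 (Lp ℝ 2 (gaussLamMeasure lam) × Lp (EuclideanSpace ℝ (Fin 2)) 2 (gaussLamMeasure lam)) → ℝ :=
    fun V => ⟪V.snd, (memLp_weight_smul_snd hlam V.snd).toLp _⟫ -
      2 * ⟪V.snd, (memLp_fst_smul_weight_drift hlam V.fst).toLp _⟫ +
      ⟪V.fst, (memLp_weight_normSq_drift_mul hlam V.fst).toLp _⟫ with hRf
  have hfst := WithLp.continuous_fst 2 (Lp ℝ 2 (gaussLamMeasure lam))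
    (Lp (EuclideanSpace ℝ (Fin 2)) 2 (gaussLamMeasure lam))
  have hsnd := WithLp.continuous_snd 2 (Lp ℝ 2 (gaussLamMeasure lam))
    (Lp (EuclideanSpace ℝ (Fin 2)) 2 (gaussLamMeasure lam))
  have hXc : Continuous Xf := hfst.inner ((continuous_weight_mul_fst hlam).comp hfst)
  have hRc : Continuous Rf :=
    ((hsnd.inner ((continuous_weight_smul_snd hlam).comp hsnd)).sub
      (continuous_const.mul (hsnd.inner ((continuous_fst_smul_weight_drift hlam).comp hfst)))).add
      (hfst.inner ((continuous_weight_normSq_drift_mul hlam).comp hfst))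
  have hRD : ∀ V : WithLp 2 (Lp ℝ 2 (gaussLamMeasure lam) × Lp (EuclideanSpace ℝ (Fin 2)) 2 (gaussLamMeasure lam)),
      ∫ x, ρ x * ‖(V.snd : EuclideanSpace ℝ (Fin 2) → EuclideanSpace ℝ (Fin 2)) x -
        (V.fst : EuclideanSpace ℝ (Fin 2) → ℝ) x • bv x‖ ^ 2 ∂gaussLamMeasure lam = Rf V := fun V =>
    (integral_weight_mul_norm_sub_smul_sq_eq hlam V.fst V.snd).2
  rw [hRD U]
  obtain ⟨φ, hlim⟩ := exists_seq_tendsto_gaussLamGraph hU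
  have h1 : Tendsto (fun n => (gaussLamGraph lam (φ n)).fst) atTop (𝓝 U.fst) := (hfst.tendsto U).comp hlim
  -- the bounds along the sequence
  set C : ℕ → ℝ := fun n => 2 * Real.sqrt (Xf (gaussLamGraph lam (φ n))) *
    Real.sqrt (Rf (gaussLamGraph lam (φ n))) with hC_def
  have hCl : Tendsto C atTop (𝓝 (2 * Real.sqrt (Xf U) * Real.sqrt (Rf U))) :=
    ((((hXc.tendsto U).comp hlim).sqrt.const_mul 2).mul ((hRc.tendsto U).comp hlim).sqrt)
  -- the weight `ρ/|y − x₀|` against `μ_λ`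
  set wt : EuclideanSpace ℝ (Fin 2) → ℝ := fun y => ρ y / ‖y - x₀‖ with hwt
  have hwtm : Measurable wt :=
    hρc.measurable.div (continuous_norm.comp (continuous_id.sub continuous_const)).measurable
  have hC : ∀ n, ∫⁻ y, ENNReal.ofReal (wt y *
      ((gaussLamGraph lam (φ n)).fst : EuclideanSpace ℝ (Fin 2) → ℝ) y ^ 2) ∂gaussLamMeasure lam ≤
      ENNReal.ofReal (C n) := by
    intro n
    set ψ := φ n with hψ
    set f : EuclideanSpace ℝ (Fin 2) → ℝ := fun x => ρ x * (ψ : EuclideanSpace ℝ (Fin 2) → ℝ) x with hf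
    have hψc := planarTestFunctions.contDiff ψ
    have hψs := planarTestFunctions.hasCompactSupport ψ
    have hfC : ContDiff ℝ 1 f := ((contDiff_exp_neg_quadraticLam lam).mul hψc).of_le (by simp)
    have hfs : HasCompactSupport f := hψs.mul_left
    obtain ⟨hintn, hlen⟩ := integral_sq_div_norm_sub_le hfC hfs x₀
    have hae := MemLp.coeFn_toLp (memLp_planarTestFunction lam ψ)
    have haeG := MemLp.coeFn_toLp (memLp_gradient_planarTestFunction lam ψ)
    -- identify the flat quantities of `f` with `Xf`, `Rf` of the graph
    have eX : Xf (gaussLamGraph lam ψ) = ∫ x, f x ^ 2 := by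
      simp only [hXf]
      rw [inner_fst_weightMul_fst_eq hlam, integral_gaussLamMeasure]
      refine integral_congr_ae ((ae_gaussLamMeasure_iff lam).1 ?_)
      filter_upwards [hae] with x hx
      rw [gaussLamGraph_fst, hx, hf]
      ring
    have eD : Rf (gaussLamGraph lam ψ) = ∫ x, ‖fderiv ℝ f x‖ ^ 2 := by
      rw [← hRD, integral_gaussLamMeasure]
      refine integral_congr_ae ((ae_gaussLamMeasure_iff lam).1 ?_)
      filter_upwards [hae, haeG] with x hx hx'
      rw [gaussLamGraph_fst, gaussLamGraph_snd, hx, hx', ← norm_gradient_eq_norm_fderiv_fin_two, hf,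
        gradient_weight_mul (hψc.differentiable (by simp)), norm_smul, mul_pow,
        Real.norm_of_nonneg (Real.exp_pos _).le]
      simp only [hρ_def, hbv]
      ring
    have hintμ : Integrable (fun y => wt y * (ψ : EuclideanSpace ℝ (Fin 2) → ℝ) y ^ 2)
        (gaussLamMeasure lam) := by
      rw [integrable_gaussLamMeasure_iff]
      refine hintn.congr (Eventually.of_forall fun y => ?_)
      show f y ^ 2 / ‖y - x₀‖ = ρ y / ‖y - x₀‖ * (ψ : EuclideanSpace ℝ (Fin 2) → ℝ) y ^ 2 * ρ y
      rw [hf]; ring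
    have heq : ∫ y, wt y * (ψ : EuclideanSpace ℝ (Fin 2) → ℝ) y ^ 2 ∂gaussLamMeasure lam =
        ∫ y, f y ^ 2 / ‖y - x₀‖ := by
      rw [integral_gaussLamMeasure]
      refine integral_congr_ae (Eventually.of_forall fun y => ?_)
      show ρ y / ‖y - x₀‖ * (ψ : EuclideanSpace ℝ (Fin 2) → ℝ) y ^ 2 * ρ y = f y ^ 2 / ‖y - x₀‖
      rw [hf]; ring
    calc ∫⁻ y, ENNReal.ofReal (wt y *
          ((gaussLamGraph lam ψ).fst : EuclideanSpace ℝ (Fin 2) → ℝ) y ^ 2) ∂gaussLamMeasure lam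
        = ∫⁻ y, ENNReal.ofReal (wt y * (ψ : EuclideanSpace ℝ (Fin 2) → ℝ) y ^ 2)
            ∂gaussLamMeasure lam := by
          refine lintegral_congr_ae ?_
          filter_upwards [hae] with y hy
          rw [gaussLamGraph_fst, hy]
      _ = ENNReal.ofReal (∫ y, wt y * (ψ : EuclideanSpace ℝ (Fin 2) → ℝ) y ^ 2
            ∂gaussLamMeasure lam) :=
          (ofReal_integral_eq_lintegral_ofReal hintμ (Eventually.of_forall fun y =>
            mul_nonneg (div_nonneg (hρpos y).le (norm_nonneg _)) (sq_nonneg _))).symm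
      _ ≤ ENNReal.ofReal (C n) := by
          rw [heq]
          refine ENNReal.ofReal_le_ofReal (hlen.trans (le_of_eq ?_))
          rw [hC_def]
          simp only
          rw [eX, eD]
  have key := lintegral_weight_mul_sq_le_of_tendsto_Lp h1 hwtm hC hCl
  -- conclusion
  set c : ℝ := 2 * Real.sqrt (Xf U) * Real.sqrt (Rf U) with hc_def
  have hc0 : 0 ≤ c := by positivity
  have hmeas : AEStronglyMeasurable (fun y : EuclideanSpace ℝ (Fin 2) =>
      wt y * (U.fst : EuclideanSpace ℝ (Fin 2) → ℝ) y ^ 2) (gaussLamMeasure lam) :=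
    hwtm.aestronglyMeasurable.mul ((Lp.aestronglyMeasurable _).pow 2)
  have hnn : 0 ≤ᵐ[gaussLamMeasure lam] fun y : EuclideanSpace ℝ (Fin 2) =>
      wt y * (U.fst : EuclideanSpace ℝ (Fin 2) → ℝ) y ^ 2 :=
    Eventually.of_forall fun y => mul_nonneg (div_nonneg (hρpos y).le (norm_nonneg _)) (sq_nonneg _)
  have heq : ∫ y, (ρ y * (U.fst : EuclideanSpace ℝ (Fin 2) → ℝ) y) ^ 2 / ‖y - x₀‖ =
      ∫ y, wt y * (U.fst : EuclideanSpace ℝ (Fin 2) → ℝ) y ^ 2 ∂gaussLamMeasure lam := by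
    rw [integral_gaussLamMeasure]
    refine integral_congr_ae (Eventually.of_forall fun y => ?_)
    show (ρ y * (U.fst : EuclideanSpace ℝ (Fin 2) → ℝ) y) ^ 2 / ‖y - x₀‖ =
      ρ y / ‖y - x₀‖ * (U.fst : EuclideanSpace ℝ (Fin 2) → ℝ) y ^ 2 * ρ y
    ring
  rw [heq, integral_eq_lintegral_of_nonneg_ae hnn hmeas]
  exact ENNReal.toReal_le_of_le_ofReal hc0 key

/-- **The flat velocity bound on `H¹(μ_λ)`**: for `U = (u, G) ∈ H`, `w = ρ_λ u`, every `x₀` and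
every `t > 0`,
`∫ ‖w(y) K_{2D}(x₀ − y)‖ dy ≤ (2π)⁻¹ ((t · 2‖w‖₂‖∇w‖₂ + t⁻¹ I₁)/2 + ‖w‖₁)` with the flat norms
`‖w‖₂² = ⟪u,(ρU)₁⟫`, `‖∇w‖₂² = ∫ρ‖G − ub‖²dμ_λ`, `‖w‖₁ = ∫|ρu|`, `I₁ = ∫_{|z|<1}|z|⁻¹dz` (the
majorant `abs_mul_norm_biotSavartKernel2D_le` integrated, with the flat Hardy bound). [folklore] -/
theorem integral_norm_weight_mul_smul_biotSavartKernel2D_le_flat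
    {U : WithLp 2 (Lp ℝ 2 (gaussLamMeasure lam) × Lp (EuclideanSpace ℝ (Fin 2)) 2 (gaussLamMeasure lam))}
    (hU : U ∈ gaussLamFormDomain lam) (x₀ : EuclideanSpace ℝ (Fin 2)) {t : ℝ} (ht : 0 < t) :
    ∫ y, ‖(Real.exp (-((1 + lam) / 4 * y 0 ^ 2 + (1 - lam) / 4 * y 1 ^ 2)) *
          (U.fst : EuclideanSpace ℝ (Fin 2) → ℝ) y) • biotSavartKernel2D (x₀ - y)‖ ≤
      (2 * Real.pi)⁻¹ * ((t * (2 * Real.sqrt ⟪U.fst, (memLp_weight_mul_fst hlam U.fst).toLp _⟫ *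
        Real.sqrt (∫ x, Real.exp (-((1 + lam) / 4 * x 0 ^ 2 + (1 - lam) / 4 * x 1 ^ 2)) *
          ‖(U.snd : EuclideanSpace ℝ (Fin 2) → EuclideanSpace ℝ (Fin 2)) x -
            (U.fst : EuclideanSpace ℝ (Fin 2) → ℝ) x •
              (toLp 2 ![(1 + lam) / 2 * x 0, (1 - lam) / 2 * x 1] : EuclideanSpace ℝ (Fin 2))‖ ^ 2
          ∂gaussLamMeasure lam)) +
          t⁻¹ * ∫ z, indicator (ball (0 : EuclideanSpace ℝ (Fin 2)) 1) (fun z => ‖z‖⁻¹) z) / 2 +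
        ∫ y, |Real.exp (-((1 + lam) / 4 * y 0 ^ 2 + (1 - lam) / 4 * y 1 ^ 2)) *
          (U.fst : EuclideanSpace ℝ (Fin 2) → ℝ) y|) := by
  set w : EuclideanSpace ℝ (Fin 2) → ℝ := fun y =>
    Real.exp (-((1 + lam) / 4 * y 0 ^ 2 + (1 - lam) / 4 * y 1 ^ 2)) *
      (U.fst : EuclideanSpace ℝ (Fin 2) → ℝ) y with hw_def
  set I₁ : ℝ := ∫ z, indicator (ball (0 : EuclideanSpace ℝ (Fin 2)) 1) (fun z => ‖z‖⁻¹) z with hI₁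
  set Hd : ℝ := 2 * Real.sqrt ⟪U.fst, (memLp_weight_mul_fst hlam U.fst).toLp _⟫ *
        Real.sqrt (∫ x, Real.exp (-((1 + lam) / 4 * x 0 ^ 2 + (1 - lam) / 4 * x 1 ^ 2)) *
          ‖(U.snd : EuclideanSpace ℝ (Fin 2) → EuclideanSpace ℝ (Fin 2)) x -
            (U.fst : EuclideanSpace ℝ (Fin 2) → ℝ) x •
              (toLp 2 ![(1 + lam) / 2 * x 0, (1 - lam) / 2 * x 1] : EuclideanSpace ℝ (Fin 2))‖ ^ 2
          ∂gaussLamMeasure lam) with hHd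
  obtain ⟨hHi, -⟩ := integral_sq_weight_div_norm_sub_le_of_mem hlam hU x₀
  have hHle := integral_sq_weight_div_norm_sub_le_flat hlam hU x₀
  obtain ⟨hwi, -⟩ := integrable_weight_mul_Lp hlam U.fst
  have hA : Integrable fun y => t * (w y ^ 2 * ‖x₀ - y‖⁻¹) := by
    refine (hHi.congr (Eventually.of_forall fun y => ?_)).const_mul t
    show w y ^ 2 / ‖y - x₀‖ = w y ^ 2 * ‖x₀ - y‖⁻¹
    rw [div_eq_mul_inv, norm_sub_rev]
  have hB : Integrable fun y => t⁻¹ * indicator (ball (0 : EuclideanSpace ℝ (Fin 2)) 1)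
      (fun z => ‖z‖⁻¹) (x₀ - y) :=
    (integrable_indicator_inv_norm.comp_sub_left x₀).const_mul _
  have hAB : Integrable fun y => t * (w y ^ 2 * ‖x₀ - y‖⁻¹) + t⁻¹ *
      indicator (ball (0 : EuclideanSpace ℝ (Fin 2)) 1) (fun z => ‖z‖⁻¹) (x₀ - y) := hA.add hB
  have hAB2 : Integrable fun y => (t * (w y ^ 2 * ‖x₀ - y‖⁻¹) + t⁻¹ *
      indicator (ball (0 : EuclideanSpace ℝ (Fin 2)) 1) (fun z => ‖z‖⁻¹) (x₀ - y)) / 2 :=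
    hAB.div_const 2
  have hwa : Integrable fun y => |w y| := hwi.abs
  have hmaj : Integrable fun y => (2 * Real.pi)⁻¹ *
      ((t * (w y ^ 2 * ‖x₀ - y‖⁻¹) + t⁻¹ * indicator (ball (0 : EuclideanSpace ℝ (Fin 2)) 1)
        (fun z => ‖z‖⁻¹) (x₀ - y)) / 2 + |w y|) := (hAB2.add hwa).const_mul _
  -- integrate the pointwise majorant
  have hstep1 : ∫ y, ‖w y • biotSavartKernel2D (x₀ - y)‖ ≤ (2 * Real.pi)⁻¹ *
      ((t * (∫ y, w y ^ 2 * ‖x₀ - y‖⁻¹) + t⁻¹ * I₁) / 2 + ∫ y, |w y|) := by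
    have hle := integral_mono_of_nonneg (Eventually.of_forall fun y => norm_nonneg _) hmaj
      (Eventually.of_forall fun y => (?_ : ‖w y • biotSavartKernel2D (x₀ - y)‖ ≤ _))
    · refine hle.trans (le_of_eq ?_)
      rw [integral_const_mul, integral_add hAB2 hwa, integral_div, integral_add hA hB,
        integral_const_mul, integral_const_mul, hI₁,
        integral_sub_left_eq_self (indicator (ball (0 : EuclideanSpace ℝ (Fin 2)) 1) fun z => ‖z‖⁻¹)
          volume x₀]
    · rw [norm_smul, Real.norm_eq_abs, norm_biotSavartKernel2D]
      exact abs_mul_norm_biotSavartKernel2D_le ht (w y) (x₀ - y)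
  have hAle : ∫ y, w y ^ 2 * ‖x₀ - y‖⁻¹ ≤ Hd := by
    have heq : ∫ y, w y ^ 2 * ‖x₀ - y‖⁻¹ = ∫ y, w y ^ 2 / ‖y - x₀‖ :=
      integral_congr_ae (Eventually.of_forall fun y => by
        show w y ^ 2 * ‖x₀ - y‖⁻¹ = w y ^ 2 / ‖y - x₀‖
        rw [div_eq_mul_inv, norm_sub_rev])
    rw [heq]
    exact hHle
  calc ∫ y, ‖w y • biotSavartKernel2D (x₀ - y)‖ ≤ (2 * Real.pi)⁻¹ *
        ((t * (∫ y, w y ^ 2 * ‖x₀ - y‖⁻¹) + t⁻¹ * I₁) / 2 + ∫ y, |w y|) := hstep1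
    _ ≤ (2 * Real.pi)⁻¹ * ((t * Hd + t⁻¹ * I₁) / 2 + ∫ y, |w y|) := by gcongr

/-- **`‖(K_{2D} ∗ w)(x₀)‖ ≤ (2π)⁻¹ ((t · 2‖w‖₂‖∇w‖₂ + t⁻¹ I₁)/2 + ‖w‖₁)`** for `w = ρ_λ u`, `U ∈ H`,
every `x₀` and every `t > 0` (flat norms as above). [folklore] -/
theorem norm_biotSavart2D_weight_mul_le_flat
    {U : WithLp 2 (Lp ℝ 2 (gaussLamMeasure lam) × Lp (EuclideanSpace ℝ (Fin 2)) 2 (gaussLamMeasure lam))}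
    (hU : U ∈ gaussLamFormDomain lam) (x₀ : EuclideanSpace ℝ (Fin 2)) {t : ℝ} (ht : 0 < t) :
    ‖biotSavart2D (fun y : EuclideanSpace ℝ (Fin 2) =>
        Real.exp (-((1 + lam) / 4 * y 0 ^ 2 + (1 - lam) / 4 * y 1 ^ 2)) *
          (U.fst : EuclideanSpace ℝ (Fin 2) → ℝ) y) x₀‖ ≤
      (2 * Real.pi)⁻¹ * ((t * (2 * Real.sqrt ⟪U.fst, (memLp_weight_mul_fst hlam U.fst).toLp _⟫ *
        Real.sqrt (∫ x, Real.exp (-((1 + lam) / 4 * x 0 ^ 2 + (1 - lam) / 4 * x 1 ^ 2)) *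
          ‖(U.snd : EuclideanSpace ℝ (Fin 2) → EuclideanSpace ℝ (Fin 2)) x -
            (U.fst : EuclideanSpace ℝ (Fin 2) → ℝ) x •
              (toLp 2 ![(1 + lam) / 2 * x 0, (1 - lam) / 2 * x 1] : EuclideanSpace ℝ (Fin 2))‖ ^ 2
          ∂gaussLamMeasure lam)) +
          t⁻¹ * ∫ z, indicator (ball (0 : EuclideanSpace ℝ (Fin 2)) 1) (fun z => ‖z‖⁻¹) z) / 2 +
        ∫ y, |Real.exp (-((1 + lam) / 4 * y 0 ^ 2 + (1 - lam) / 4 * y 1 ^ 2)) *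
          (U.fst : EuclideanSpace ℝ (Fin 2) → ℝ) y|) := by
  unfold biotSavart2D
  exact (norm_integral_le_integral_norm _).trans
    (integral_norm_weight_mul_smul_biotSavartKernel2D_le_flat hlam hU x₀ ht)

end Velocity

end Literature.Analysis.FluidPDE
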